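/-
Copyright (c) 2026 the pub-hodgecm-mathlib formalisation cell (harness21).  Prover seat hodgecm-mathlib-K2Liu-p02 (g4), Track B «K2-LIT» ∕
hLiu418 #184♮, socket #42F′ road I (LEAD F0P6-plan (g11) rulings «M-155k» (2)–(4), «M-155p»; WORDS-42F organ «WittFrame»), 2026-09-04.
-/
import Summits.HodgeConjecture.HodgeConjecture.Theorems.K2LiuHermitianWittTransitive
import Mathlib.LinearAlgebra.Finsupp.LinearCombination
import Mathlib.Tactic.FieldSimp
import Mathlib.Tactic.Ring
import Mathlib.Tactic.FinCases

/-!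
# Crux `HLiu418`, road `K2_Liu`, organ «WittFrame» (S): an ISOTROPIC non-degenerate hermitian space splits off a hyperbolic plane —
# in rank `3`, a Witt frame `(x, m, x*)` with `h(x,x) = h(x*,x*) = 0`, `h(x,x*) = 1`, `m ⊥ x, x*`, `h(m,m) = a′ ≠ 0` real

Cell `hodgecm-mathlib`, crux item hLiu418 = `stmt-HodgeConjecture-24832`; squad K2 ∕ K2Liu, prover K2Liu-p02 (g4).  THEOREMS ONLY (no `def` ∕
instance ∕ notation ∕ named-fact hypothesis ∕ `sorry`); lane `--supports stmt-HodgeConjecture-24832 --as helper` (count-neutral).  Sequel of ★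
`K2LiuHermitianWittTransitive` (same abstract currency: a `c`-hermitian, left non-degenerate `B : V →ₛₗ[c] V →ₗ[L] L`, `c` involutive, `2 ≠ 0`).

The first-term identity on the twisted Siegel–Weil generators (#42F′, [GanQiuTakeda2014 §7 Thm 20 (i)] at `(n,m,m′,r,r′) = (2,3,1,1,0)`) reads the
ISOTROPIC hermitian 3-space `V′` through a Witt decomposition `V′ = X′ ⊕ ⟨a′⟩ ⊕ X′*` (print: the complementary LINE `⟨a′⟩`, `r′ = 0`); the Ikeda
map of ★ `K2LiuIkedaMapDefs` is indexed by that splitting.  This file supplies the frame (proof-side under the adopted cut (T-∃) of U6 ED. 10):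

* §1 `apply_smul_right`, `apply_sub_sub` — bookkeeping for `B u (z − s • u − t • u′)`;
* §2 **`exists_hyperbolic_partner`**: a non-zero isotropic `u` has an ISOTROPIC partner `u′` with `B u u′ = 1` (non-degeneracy gives `x` with
  `B u x = 1`; `u′ = x − (B x x ∕ 2) • u`);
* §3 **`exists_orthogonal_decomposition`**: for a hyperbolic pair `(u, u′)` every `z` is `(B u′ z) • u + (B u z) • u′ + m` with `m ⊥ u, u′`;
* §4 **`exists_wittFrame_three`**: in `finrank 3`, an isotropic non-zero vector yields a Witt frame `(u, m, u′)`: `B u u = B u′ u′ = 0`, `B u u′ = 1`,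
  `B u m = B u′ m = 0`, `B m m ≠ 0` with `c (B m m) = B m m`, and `(u, m, u′)` linearly independent (a basis).

HONEST LABEL.  Count-neutral helper; it pays nothing by itself: `HC_CM` is proved only modulo the 7 printed citations (2 remaining named inputs:
hLiu418 = `stmt-HodgeConjecture-24832`, h413 = `stmt-HodgeConjecture-24833`) until rung 0 closes.
References: [Scharlau1985HermitianForms] Ch. 7 §9 (hermitian Witt decomposition); [GanQiuTakeda2014] §7 Thm 20 (i) (the line `⟨a′⟩`);
[Liu2021] App. B §B.3 p. 101.
-/

set_option autoImplicit false
-- the mandated namespace repeats the single-problem summit's segment (`HodgeConjecture.HodgeConjecture`)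
set_option linter.dupNamespace false

namespace Summit.HodgeConjecture.HodgeConjecture.Cruxes.HLiu418.K2LiuHermitianWittFrame

open Module Summit.HodgeConjecture.HodgeConjecture.Cruxes.HLiu418.K2LiuHermitianWitt

variable {L V : Type*} [Field L] [AddCommGroup V] [Module L V] {c : L →+* L}

/-! ## §1 Bookkeeping -/

/-- `B (a • x) y = c a * B x y`. [cite: Scharlau1985HermitianForms, Ch. 7 §9] -/
theorem apply_smul_left (B : V →ₛₗ[c] V →ₗ[L] L) (a : L) (x y : V) : B (a • x) y = c a * B x y := by
  rw [LinearMap.map_smulₛₗ, LinearMap.smul_apply, smul_eq_mul]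

/-- `B u (z − s • u − t • u′) = B u z − s * B u u − t * B u u′`. [cite: Scharlau1985HermitianForms, Ch. 7 §9] -/
theorem apply_sub_sub (B : V →ₛₗ[c] V →ₗ[L] L) (u z v w : V) (s t : L) :
    B u (z - s • v - t • w) = B u z - s * B u v - t * B u w := by
  rw [map_sub, map_sub, map_smul, map_smul, smul_eq_mul, smul_eq_mul]

/-- a real scalar halves: `c (r / 2) = r / 2` when `c r = r`. [cite: Scharlau1985HermitianForms, Ch. 7 §9] -/
theorem conj_div_two (r : L) (hr : c r = r) : c (r / 2) = r / 2 := by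
  rw [map_div₀, hr, map_ofNat]

/-- expansion of `B (x − r • u) (x − r • u)`. [cite: Scharlau1985HermitianForms, Ch. 7 §9] -/
theorem apply_sub_smul_self (B : V →ₛₗ[c] V →ₗ[L] L) (x u : V) (r : L) :
    B (x - r • u) (x - r • u) = B x x - r * B x u - c r * B u x + c r * r * B u u := by
  simp only [map_sub, LinearMap.map_smulₛₗ, LinearMap.sub_apply, LinearMap.smul_apply, map_smul, smul_eq_mul]
  ring

/-! ## §2 The hyperbolic partner of an isotropic vector -/

/-- **an isotropic non-zero vector has an isotropic partner**: `B u u = 0`, `u ≠ 0` ⇒ `∃ u′, B u′ u′ = 0 ∧ B u u′ = 1` (left non-degeneracy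
gives `x` with `B u x = 1`; then `u′ := x − (B x x ∕ 2) • u`, using `c` involutive-hermitian and `2 ≠ 0`). [cite: Scharlau1985HermitianForms, Ch. 7 §9] -/
theorem exists_hyperbolic_partner (B : V →ₛₗ[c] V →ₗ[L] L) (h2 : (2 : L) ≠ 0) (hH : ∀ x y, c (B x y) = B y x)
    (hnd : ∀ x, (∀ y, B x y = 0) → x = 0) {u : V} (hu0 : u ≠ 0) (hu : B u u = 0) :
    ∃ u' : V, B u' u' = 0 ∧ B u u' = 1 := by
  -- some `y` pairs non-trivially with `u`
  obtain ⟨y, hy⟩ : ∃ y, B u y ≠ 0 := by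
    by_contra h
    exact hu0 (hnd u fun y => not_not.mp (not_exists.mp h y))
  -- rescale: `B u x = 1`
  obtain ⟨x, hux⟩ : ∃ x, B u x = 1 := ⟨(B u y)⁻¹ • y, by rw [map_smul, smul_eq_mul, inv_mul_cancel₀ hy]⟩
  have hxu : B x u = 1 := by rw [← hH u x, hux, map_one]
  have hxx : c (B x x) = B x x := hH x x
  refine ⟨x - (B x x / 2) • u, ?_, ?_⟩
  · -- `B u′ u′ = B x x − r − r + 0 = 0`, `r = B x x / 2`
    rw [apply_sub_smul_self, hxu, hux, hu, conj_div_two _ hxx]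
    field_simp
    ring
  · rw [map_sub, map_smul, smul_eq_mul, hux, hu, mul_zero, sub_zero]

/-! ## §3 Splitting off the hyperbolic plane -/

/-- **orthogonal decomposition along a hyperbolic pair**: for `B u u = B u′ u′ = 0`, `B u u′ = 1`, every `z` is
`(B u′ z) • u + (B u z) • u′ + m` with `B u m = 0 = B u′ m` (`m := z − (B u′ z) • u − (B u z) • u′`). [cite: Scharlau1985HermitianForms, Ch. 7 §9] -/
theorem exists_orthogonal_decomposition (B : V →ₛₗ[c] V →ₗ[L] L) (hH : ∀ x y, c (B x y) = B y x) {u u' : V}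
    (hu : B u u = 0) (hu' : B u' u' = 0) (huu' : B u u' = 1) (z : V) :
    ∃ m : V, B u m = 0 ∧ B u' m = 0 ∧ z = (B u' z) • u + (B u z) • u' + m := by
  have hu'u : B u' u = 1 := by rw [← hH u u', huu', map_one]
  refine ⟨z - (B u' z) • u - (B u z) • u', ?_, ?_, ?_⟩
  · rw [apply_sub_sub, hu, huu', mul_zero, sub_zero, mul_one, sub_self]
  · rw [apply_sub_sub, hu'u, hu', mul_one, mul_zero, sub_zero, sub_self]
  · abel

/-! ## §4 The Witt frame of an isotropic non-degenerate hermitian `3`-space -/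

/-- **Witt frame in rank `3`**: a non-degenerate `c`-hermitian space of `finrank 3` with a non-zero isotropic vector has a frame `(u, m, u′)` with
`B u u = B u′ u′ = 0`, `B u u′ = 1`, `B u m = B u′ m = 0`, `B m m ≠ 0` real (`c (B m m) = B m m`), `(u, m, u′)` linearly independent — i.e.
`V = X ⊕ ⟨m⟩ ⊕ X*` with `X = Lu`, `X* = Lu′` isotropic in duality and the complementary LINE `⟨B m m⟩` (`r′ = 0` in [GanQiuTakeda2014]'s notation).
[cite: Scharlau1985HermitianForms, Ch. 7 §9] [cite: GanQiuTakeda2014, §7 Thm 20 (i)] -/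
theorem exists_wittFrame_three [FiniteDimensional L V] (B : V →ₛₗ[c] V →ₗ[L] L) (h2 : (2 : L) ≠ 0)
    (hH : ∀ x y, c (B x y) = B y x) (hnd : ∀ x, (∀ y, B x y = 0) → x = 0) (h3 : finrank L V = 3)
    {u : V} (hu0 : u ≠ 0) (hu : B u u = 0) :
    ∃ m u' : V, B u' u' = 0 ∧ B u u' = 1 ∧ B u m = 0 ∧ B u' m = 0 ∧ B m m ≠ 0 ∧ c (B m m) = B m m ∧
      LinearIndependent L ![u, m, u'] := by
  classical
  obtain ⟨u', hu', huu'⟩ := exists_hyperbolic_partner B h2 hH hnd hu0 hu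
  have hu'u : B u' u = 1 := by rw [← hH u u', huu', map_one]
  -- the plane `P = ⟨u, u′⟩` is proper (`finrank P ≤ 2 < 3`): pick `z ∉ P`
  let P : Submodule L V := Submodule.span L ((({u, u'} : Finset V) : Set V))
  have hP : finrank L P ≤ 2 :=
    (finrank_span_finset_le_card ({u, u'} : Finset V)).trans ((Finset.card_insert_le _ _).trans (by rw [Finset.card_singleton]))
  have hPtop : P ≠ ⊤ := by
    intro h
    have h' := hP
    rw [h, finrank_top, h3] at h'
    omega
  obtain ⟨z, -, hz⟩ := SetLike.exists_of_lt (lt_top_iff_ne_top.mpr hPtop)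
  -- its component `m` orthogonal to the plane
  obtain ⟨m, hum, hu'm, hzm⟩ := exists_orthogonal_decomposition B hH hu hu' huu' z
  have hmu : B m u = 0 := eq_zero_comm B hH hum
  have hmu' : B m u' = 0 := eq_zero_comm B hH hu'm
  -- `m ≠ 0` (else `z ∈ P`)
  have huP : u ∈ P := Submodule.subset_span (by simp)
  have hu'P : u' ∈ P := Submodule.subset_span (by simp)
  have hm0 : m ≠ 0 := by
    intro hm
    apply hz
    rw [hzm, hm, add_zero]
    exact P.add_mem (P.smul_mem _ huP) (P.smul_mem _ hu'P)
  -- `(u, m, u′)` is linearly independent: test against `B u`, `B u′`, then `m ≠ 0`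
  have hli : LinearIndependent L ![u, m, u'] := by
    rw [Fintype.linearIndependent_iff]
    intro g hg
    rw [Fin.sum_univ_three] at hg
    simp only [Matrix.cons_val_zero, Matrix.cons_val_one, Matrix.head_cons, Matrix.cons_val_two, Matrix.tail_cons] at hg
    have h1 := congrArg (B u) hg
    rw [map_add, map_add, map_smul, map_smul, map_smul, smul_eq_mul, smul_eq_mul, smul_eq_mul, hu, hum, huu', map_zero,
      mul_zero, mul_zero, zero_add, zero_add, mul_one] at h1
    have h0 := congrArg (B u') hg
    rw [map_add, map_add, map_smul, map_smul, map_smul, smul_eq_mul, smul_eq_mul, smul_eq_mul, hu'u, hu'm, hu', map_zero,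
      mul_one, mul_zero, mul_zero, add_zero, add_zero] at h0
    rw [h0, h1, zero_smul, zero_smul, zero_add, add_zero] at hg
    have hg1 : g 1 = 0 := (smul_eq_zero.mp hg).resolve_right hm0
    intro i
    fin_cases i
    · exact h0
    · exact hg1
    · exact h1
  -- `B m m ≠ 0`: otherwise `m` is in the left kernel (it kills the basis `(u, m, u′)`)
  have hspan : Submodule.span L (Set.range ![u, m, u']) = ⊤ :=
    hli.span_eq_top_of_card_eq_finrank (by rw [Fintype.card_fin, h3])
  have hmm : B m m ≠ 0 := by
    intro hmm
    apply hm0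
    apply hnd
    intro y
    have hy : y ∈ Submodule.span L (Set.range ![u, m, u']) := by rw [hspan]; exact Submodule.mem_top
    obtain ⟨g, rfl⟩ := (Submodule.mem_span_range_iff_exists_fun (R := L)).mp hy
    rw [map_sum, Finset.sum_eq_zero]
    intro i _
    rw [map_smul, smul_eq_mul]
    fin_cases i
    · exact (congrArg (g 0 * ·) hmu).trans (mul_zero _)
    · exact (congrArg (g 1 * ·) hmm).trans (mul_zero _)
    · exact (congrArg (g 2 * ·) hmu').trans (mul_zero _)
  exact ⟨m, u', hu', huu', hum, hu'm, hmm, hH m m, hli⟩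

end Summit.HodgeConjecture.HodgeConjecture.Cruxes.HLiu418.K2LiuHermitianWittFrame
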